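import Literature.NumberTheory.EllipticCurves.MultiplicativeReductionJValuationProofs
import HarnessLib

/-!
# `4 ∣ ord_v(c₄)` and `6 ∣ ord_v(c₆)` at a place of multiplicative reduction (any model, any Dedekind domain)

`Proofs` file (theorems only: no definition, no named fact), topic `NumberTheory/EllipticCurves`,
companion of `MultiplicativeReductionJValuationProofs` (`ord_v j = −ord_v Δ_min` at a multiplicative
place). J. H. Silverman, *The Arithmetic of Elliptic Curves*, 2nd ed. (2009), Prop. VII.5.1 (b) and
III.1 Table 3.1: a minimal Weierstrass equation at `v` with multiplicative reduction has `v(c₄) = 0`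
(and `v(Δ) > 0`, whence `v(c₆) = 0` by `1728 Δ = c₄³ − c₆²`); an arbitrary equation `W` of the same
curve over `K` differs from it by a change of variables `(u, r, s, t)` over `K_v`, under which
`c₄ ↦ u⁻⁴ c₄`, `c₆ ↦ u⁻⁶ c₆`. Hence, for ANY Weierstrass equation `W` over the fraction field `K` of a
Dedekind domain with multiplicative reduction at the finite place `v`:

* `WeierstrassCurve.four_dvd_log_valuation_c₄_of_hasMultiplicativeReductionAt` — `c₄(W) ≠ 0` and
  `4 ∣ log v(c₄(W))` (i.e. `ord_v c₄(W) ≡ 0 (mod 4)`);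
* `WeierstrassCurve.six_dvd_log_valuation_c₆_of_hasMultiplicativeReductionAt` — `c₆(W) ≠ 0` and
  `6 ∣ log v(c₆(W))`.

(The abc-iut consumer: the parity of the ramification index of a field over which a quadratic twist
of a curve with multiplicative reduction stays multiplicative — the «twist factor `2`» of the R-W
window table's local types.) Classical; nothing here bears on anything disputed.

## References

* [SilvermanAEC2009] J. H. Silverman, *The Arithmetic of Elliptic Curves*, 2nd ed. (2009),
  Prop. VII.5.1 (b), III.1 Table 3.1, III.1 (`1728 Δ = c₄³ − c₆²`).
-/

noncomputable section

open IsDedekindDomain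

namespace WeierstrassCurve

variable {A : Type*} [CommRing A] [IsDedekindDomain A] {K : Type*} [Field K] [Algebra A K]
  [IsFractionRing A K] (v : HeightOneSpectrum A) (W : WeierstrassCurve K)

/-- **`4 ∣ ord_v c₄(W)` at a place of multiplicative reduction** (Silverman *AEC* VII.5.1 (b) with
III.1 Table 3.1: the local minimal model `E = C • (W ⊗ K_v)` has `v(c₄(E)) = 0` and
`c₄(E) = u⁻⁴ c₄(W)`, so `v(c₄(W)) = v(u)⁴`), for a Weierstrass curve over the fraction field `K` of a
Dedekind domain `A` and a finite place `v`; `v.valuation K` has values `exp(−ord_v)` in `ℤᵐ⁰`, and the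
statement is `c₄(W) ≠ 0 ∧ (4 : ℤ) ∣ log (v.valuation K c₄(W))`. [cite: SilvermanAEC2009, Prop. VII.5.1(b)] -/
theorem four_dvd_log_valuation_c₄_of_hasMultiplicativeReductionAt [W.IsElliptic]
    (hv : W.HasMultiplicativeReductionAt v) :
    W.c₄ ≠ 0 ∧ (4 : ℤ) ∣ WithZero.log (v.valuation K W.c₄) := by
  haveI := W.isElliptic_localMinimalModel v
  set Kv := v.adicCompletion K
  set E := W.localMinimalModel v with hE
  have hm : E.HasMultiplicativeReduction (v.adicCompletionIntegers K) := hv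
  set C : VariableChange Kv :=
    ((W.baseChange Kv).exists_isMinimal (v.adicCompletionIntegers K)).choose with hCdef
  -- `c₄(E) = u⁻⁴ · c₄(W)` in `K_v`
  have hc₄E : E.c₄ = (C.u⁻¹ : Kvˣ) ^ 4 * algebraMap K Kv W.c₄ := by
    change (C • W.baseChange Kv).c₄ = _
    rw [variableChange_c₄]
    congr 1
    exact W.map_c₄ _
  -- `c₄(E)` is a `v`-adic unit: `Valued.v c₄(E) = 1`
  have hequiv := WeierstrassCurve.isEquiv_valuation_maximalIdeal_of_le_one_iff
    (WeierstrassCurve.valued_le_one_iff_mem_range_adicCompletionIntegers v (K := K))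
  have hc₄ : (Valued.v : Valuation Kv (WithZero (Multiplicative ℤ))) E.c₄ = 1 :=
    (Valuation.isEquiv_iff_val_eq_one.mp hequiv).mp hm.multiplicativeReduction
  -- hence `v(c₄(W)) = v(u)⁴`
  have hu0 : (Valued.v : Valuation Kv (WithZero (Multiplicative ℤ))) (C.u : Kv) ≠ 0 :=
    (Valuation.ne_zero_iff _).mpr C.u.ne_zero
  have hval : v.valuation K W.c₄ =
      ((Valued.v : Valuation Kv (WithZero (Multiplicative ℤ))) (C.u : Kv)) ^ 4 := by
    have h := congrArg (Valued.v : Valuation Kv (WithZero (Multiplicative ℤ))) hc₄E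
    rw [hc₄, map_mul, map_pow, Units.val_inv_eq_inv_val, map_inv₀,
      WeierstrassCurve.valued_algebraMap_adicCompletion] at h
    -- `1 = (v u)⁻¹ ^ 4 * v(c₄ W)`
    have h4 : ((Valued.v : Valuation Kv (WithZero (Multiplicative ℤ))) (C.u : Kv)) ^ 4 ≠ 0 :=
      pow_ne_zero 4 hu0
    field_simp at h
    exact h.symm
  set a : ℤ := WithZero.log ((Valued.v : Valuation Kv (WithZero (Multiplicative ℤ))) (C.u : Kv)) with ha
  have hua : (Valued.v : Valuation Kv (WithZero (Multiplicative ℤ))) (C.u : Kv) = WithZero.exp a := by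
    rw [ha, WithZero.exp_log hu0]
  refine ⟨?_, ⟨a, ?_⟩⟩
  · intro h0
    rw [h0, map_zero] at hval
    exact pow_ne_zero 4 hu0 hval.symm
  · rw [hval, hua, ← WithZero.exp_nsmul, WithZero.log_exp, nsmul_eq_mul]
    ring

/-- **`6 ∣ ord_v c₆(W)` at a place of multiplicative reduction** (same source: on the local minimal
model `v(Δ) > 0`, `v(c₄) = 0` force `v(c₆) = 0` by `1728 Δ = c₄³ − c₆²`, and `c₆(E) = u⁻⁶ c₆(W)`); stated
as `c₆(W) ≠ 0 ∧ (6 : ℤ) ∣ log (v.valuation K c₆(W))`. [cite: SilvermanAEC2009, Prop. VII.5.1(b)] -/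
theorem six_dvd_log_valuation_c₆_of_hasMultiplicativeReductionAt [W.IsElliptic]
    (hv : W.HasMultiplicativeReductionAt v) :
    W.c₆ ≠ 0 ∧ (6 : ℤ) ∣ WithZero.log (v.valuation K W.c₆) := by
  haveI := W.isElliptic_localMinimalModel v
  set Kv := v.adicCompletion K
  set E := W.localMinimalModel v with hE
  have hm : E.HasMultiplicativeReduction (v.adicCompletionIntegers K) := hv
  set C : VariableChange Kv :=
    ((W.baseChange Kv).exists_isMinimal (v.adicCompletionIntegers K)).choose with hCdef
  have hc₆E : E.c₆ = (C.u⁻¹ : Kvˣ) ^ 6 * algebraMap K Kv W.c₆ := by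
    change (C • W.baseChange Kv).c₆ = _
    rw [variableChange_c₆]
    congr 1
    exact W.map_c₆ _
  have hequiv := WeierstrassCurve.isEquiv_valuation_maximalIdeal_of_le_one_iff
    (WeierstrassCurve.valued_le_one_iff_mem_range_adicCompletionIntegers v (K := K))
  set V : Valuation Kv (WithZero (Multiplicative ℤ)) := Valued.v with hVdef
  have hc₄ : V E.c₄ = 1 := (Valuation.isEquiv_iff_val_eq_one.mp hequiv).mp hm.multiplicativeReduction
  have hΔ : V E.Δ < 1 := (Valuation.isEquiv_iff_val_lt_one.mp hequiv).mp hm.badReduction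
  -- `c₆(E)` is a unit: `c₆² = c₄³ − 1728 Δ` with `v(c₄³) = 1 > v(1728 Δ)`
  have h1728 : V (1728 * E.Δ) < 1 := by
    rw [map_mul]
    have h1 : V (1728 : Kv) ≤ 1 := by
      have : ((1728 : ℕ) : Kv) = algebraMap (v.adicCompletionIntegers K) Kv (1728 : ℕ) := by push_cast; rfl
      rw [show (1728 : Kv) = ((1728 : ℕ) : Kv) by norm_num, this]
      exact ((WeierstrassCurve.valued_le_one_iff_mem_range_adicCompletionIntegers v (K := K)) _).mpr
        ⟨_, rfl⟩
    calc V 1728 * V E.Δ ≤ 1 * V E.Δ := by gcongr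
      _ = V E.Δ := one_mul _
      _ < 1 := hΔ
  have hc₆ : V E.c₆ = 1 := by
    have hrel : E.c₆ ^ 2 = E.c₄ ^ 3 - 1728 * E.Δ := by
      have := E.c_relation
      linear_combination this
    have hsq : V (E.c₆ ^ 2) = 1 := by
      rw [hrel, Valuation.map_sub_eq_of_lt_left] <;> rw [map_pow, hc₄, one_pow]
      exact h1728
    rw [map_pow] at hsq
    rcases lt_trichotomy (V E.c₆) 1 with h | h | h
    · exact absurd hsq (ne_of_lt (pow_lt_one₀ zero_le h two_ne_zero))
    · exact h
    · exact absurd hsq (ne_of_gt (one_lt_pow₀ h two_ne_zero))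
  have hu0 : V (C.u : Kv) ≠ 0 := (Valuation.ne_zero_iff _).mpr C.u.ne_zero
  have hval : v.valuation K W.c₆ = (V (C.u : Kv)) ^ 6 := by
    have h := congrArg V hc₆E
    rw [hc₆, map_mul, map_pow, Units.val_inv_eq_inv_val, map_inv₀, hVdef,
      WeierstrassCurve.valued_algebraMap_adicCompletion] at h
    have h6 : (V (C.u : Kv)) ^ 6 ≠ 0 := pow_ne_zero 6 hu0
    rw [inv_pow, inv_mul_eq_div, eq_comm, div_eq_one_iff_eq h6] at h
    exact h
  set a : ℤ := WithZero.log (V (C.u : Kv)) with ha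
  have hua : V (C.u : Kv) = WithZero.exp a := by rw [ha, WithZero.exp_log hu0]
  refine ⟨?_, ⟨a, ?_⟩⟩
  · intro h0
    rw [h0, map_zero] at hval
    exact pow_ne_zero 6 hu0 hval.symm
  · rw [hval, hua, ← WithZero.exp_nsmul, WithZero.log_exp, nsmul_eq_mul]
    ring

end WeierstrassCurve

end
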